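import Mathlib
import HarnessLib
import Summits.CriticalPhenomena.PercolationContinuityZ3.Theorems.PercBoundarySqueezeHalfSpaceOneArmRateStubShellSubmult

/-!
# Crux `PercBoundarySqueeze.HalfSpaceOneArmRate` (stmt-CriticalPhenomena-6983) — submultiplicativity of the half-space shell crossing in the ratio

Helper file landed `--supports stmt-CriticalPhenomena-6983` by the line lead (line `registered`). The open stub
`stub_shellDecay` of the line asks for ONE ratio `m ≥ 2` with `P_{p_c}(ShellCross_H(r, m r)) ≤ m^{-b}` for all
`r ≥ r₀`, where

  `ShellCross_H(r,R) = {∃ w y, ‖w‖∞ ≤ r+1, ‖y‖∞ ≥ R, w ↔ y open inside H ∩ {‖x‖∞ > r}}`, `H = {x | 0 ≤ x 0}`.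

This file proves the structural fact behind the quantifier `∃ m`: the shell crossing is SUBMULTIPLICATIVE IN
THE RATIO, for every density `p` and all `r < s < R`,

  `P_p(ShellCross_H(r,R)) ≤ P_p(ShellCross_H(r,s)) · P_p(ShellCross_H(s,R))`            (`shellCross_submult`)

(first exit from the open cube `{‖x‖∞ < s}` / last exit from `Λ_s` of the crossing path; the two pieces are
determined by the pairs inside `Λ_s`, resp. inside `H ∩ {‖x‖∞ > s}`, which are disjoint, hence independent
under the product measure — the same surgery as the landed `stub_shellSubmult`, whose helpers
`StubShellSubmult.determinedBy_outer` / `measurableSet_outer` are reused). Consequently the per-scale bound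
at ratio `m` propagates to every power ratio `m^k` (`shellDecayWith_pow`): the set of admissible ratios in
`stub_shellDecay` is closed under powers, and `g(m) := sup_{r ≥ r₀} P_{p_c}(ShellCross_H(r, m r))` satisfies
`g(m m') ≤ g(m) g(m')` — the rigorous skeleton of the scaling prediction `g(m) ≈ c m^{-x_s}`.

No definitions, no sorry. Source: Grimmett, *Percolation* (1999), §2.2 (events defined on disjoint edge
sets are independent) [GrimmettPercolation1999]; Kesten's multiscale argument, Grimmett 1999 §11.7.
-/

noncomputable section

namespace Summit.CriticalPhenomena.PercolationContinuityZ3.Theorems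

namespace ShellCrossSubmult

open MeasureTheory
open Literature.Probability.Percolation Literature.Probability.LatticeModels

/-! ## Path surgery: split a shell crossing `r → R` at the intermediate scale `s` -/

/-- **Inner piece.** For `ω ⊆ E(ℤ³)` and `r < s`, an open path inside `H ∩ {‖x‖∞ > r}` from a vertex `w`
with `‖w‖∞ ≤ r+1` to a vertex of sup-norm `≥ s` contains an initial piece inside `H ∩ {‖x‖∞ > r} ∩ Λ_s`
from `w` to a vertex of sup-norm `≥ s` (stop at the first exit from the open cube `{‖x‖∞ < s}`; if `w` is
not in that cube, the trivial path at `w` will do). [folklore] -/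
theorem inner_piece {ω : BondConfig (Site 3)} (hω : ω ⊆ (zdGraph 3).edgeSet) {r s : ℕ} (hrs : r < s)
    {w y : Site 3} (hw : ∀ i : Fin 3, |w i| ≤ (r : ℤ) + 1) (hy : ∃ i : Fin 3, (s : ℤ) ≤ |y i|)
    (hp : PathIn (openGraph ω) {x : Site 3 | 0 ≤ x 0 ∧ ∃ i : Fin 3, (r : ℤ) < |x i|} w y) :
    ∃ w' y' : Site 3, (∀ i : Fin 3, |w' i| ≤ (r : ℤ) + 1) ∧ (∃ i : Fin 3, (s : ℤ) ≤ |y' i|) ∧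
      PathIn (openGraph ω) ({x : Site 3 | 0 ≤ x 0 ∧ ∃ i : Fin 3, (r : ℤ) < |x i|} ∩ ↑(box 3 s)) w' y' := by
  have hwbox : w ∈ (↑(box 3 s) : Set (Site 3)) := by
    rw [Finset.mem_coe, mem_box]
    intro i
    have h1 := abs_le.1 (hw i)
    constructor <;> omega
  by_cases hwcube : w ∈ {x : Site 3 | ∀ i : Fin 3, |x i| < (s : ℤ)}
  · -- first exit from the open cube
    have hycube : y ∉ {x : Site 3 | ∀ i : Fin 3, |x i| < (s : ℤ)} := by
      obtain ⟨i, hi⟩ := hy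
      simp only [Set.mem_setOf_eq, not_forall, not_lt]
      exact ⟨i, hi⟩
    obtain ⟨a, b, haC, hbC, hbA, hab, hpa⟩ := hp.exit hwcube hycube
    have hab' : (zdGraph 3).Adj a b := DCT16.adj_of_openGraph_adj hω hab
    have hbs : ∃ i : Fin 3, (s : ℤ) ≤ |b i| := by
      simp only [Set.mem_setOf_eq, not_forall, not_lt] at hbC
      exact hbC
    have hbbox : b ∈ (↑(box 3 s) : Set (Site 3)) := by
      rw [Finset.mem_coe, mem_box]
      intro i
      have h1 := DCT16.abs_sub_le_one_of_adj hab' i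
      have h2 : |a i| < (s : ℤ) := haC i
      rw [abs_lt] at h2
      rw [abs_le] at h1
      constructor <;> omega
    refine ⟨w, b, hw, hbs, ?_⟩
    have hsub : {x : Site 3 | ∀ i : Fin 3, |x i| < (s : ℤ)} ∩
        {x : Site 3 | 0 ≤ x 0 ∧ ∃ i : Fin 3, (r : ℤ) < |x i|} ⊆
        {x : Site 3 | 0 ≤ x 0 ∧ ∃ i : Fin 3, (r : ℤ) < |x i|} ∩ ↑(box 3 s) := by
      rintro x ⟨hxc, hxA⟩
      refine ⟨hxA, ?_⟩
      rw [Finset.mem_coe, mem_box]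
      intro i
      have h1 := hxc i
      rw [abs_lt] at h1
      constructor <;> omega
    exact (hpa.mono hsub).tail hab ⟨hbA, hbbox⟩
  · -- `w` itself already has sup-norm `≥ s`
    have hws : ∃ i : Fin 3, (s : ℤ) ≤ |w i| := by
      simp only [Set.mem_setOf_eq, not_forall, not_lt] at hwcube
      exact hwcube
    exact ⟨w, w, hw, hws, PathIn.refl ⟨hp.left_mem, hwbox⟩⟩

/-- **Outer piece.** For `ω ⊆ E(ℤ³)` and `s < R`, an open path inside `H ∩ {‖x‖∞ > r}` from a vertex of
`Λ_s` to a vertex of sup-norm `≥ R` contains, after its last exit from `Λ_s`, an open path inside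
`H ∩ {‖x‖∞ > s}` from a vertex of `Λ_{s+1}` to its endpoint. [folklore] -/
theorem outer_piece {ω : BondConfig (Site 3)} (hω : ω ⊆ (zdGraph 3).edgeSet) {r s R : ℕ} (hsR : s < R)
    {w y : Site 3} (hw : w ∈ (↑(box 3 s) : Set (Site 3))) (hy : ∃ i : Fin 3, (R : ℤ) ≤ |y i|)
    (hp : PathIn (openGraph ω) {x : Site 3 | 0 ≤ x 0 ∧ ∃ i : Fin 3, (r : ℤ) < |x i|} w y) :
    ∃ w' : Site 3, (∀ i : Fin 3, |w' i| ≤ (s : ℤ) + 1) ∧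
      PathIn (openGraph ω) {x : Site 3 | 0 ≤ x 0 ∧ ∃ i : Fin 3, (s : ℤ) < |x i|} w' y := by
  have hyC : y ∉ (↑(box 3 s) : Set (Site 3)) := by
    obtain ⟨i, hi⟩ := hy
    rw [Finset.mem_coe, mem_box, not_forall]
    refine ⟨i, fun h => ?_⟩
    rw [le_abs] at hi
    omega
  obtain ⟨a, b, haC, -, -, hab, hpb⟩ := hp.last_exit hw hyC
  have hab' : (zdGraph 3).Adj a b := DCT16.adj_of_openGraph_adj hω hab
  have hb : b ∈ box 3 (s + 1) := DCT16.mem_box_succ_of_adj (Finset.mem_coe.1 haC) hab'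
  refine ⟨b, ?_, hpb.mono ?_⟩
  · intro i
    rw [mem_box] at hb
    have h1 := hb i
    push_cast at h1
    exact abs_le.2 h1
  · rintro x ⟨⟨hxH, -⟩, hxC⟩
    refine ⟨hxH, ?_⟩
    rw [Finset.mem_coe, mem_box, not_forall] at hxC
    obtain ⟨i, hi⟩ := hxC
    refine ⟨i, ?_⟩
    rw [lt_abs]
    omega

/-- For `ω ⊆ E(ℤ³)` and `r < s < R`: `ShellCross_H(r,R) ⊆ InnerPiece(r,s) ∩ ShellCross_H(s,R)`. [folklore] -/
theorem mem_inter_of_mem_shellCross {ω : BondConfig (Site 3)} (hω : ω ⊆ (zdGraph 3).edgeSet) {r s R : ℕ}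
    (hrs : r < s) (hsR : s < R)
    (h : ω ∈ {ω : BondConfig (Site 3) | ∃ w y : Site 3, (∀ i : Fin 3, |w i| ≤ (r : ℤ) + 1) ∧
        (∃ i : Fin 3, (R : ℤ) ≤ |y i|) ∧
        ω ∈ openConnIn {x : Site 3 | 0 ≤ x 0 ∧ ∃ i : Fin 3, (r : ℤ) < |x i|} w y}) :
    ω ∈ {ω : BondConfig (Site 3) | ∃ w y : Site 3, (∀ i : Fin 3, |w i| ≤ (r : ℤ) + 1) ∧
        (∃ i : Fin 3, (s : ℤ) ≤ |y i|) ∧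
        ω ∈ openConnIn ({x : Site 3 | 0 ≤ x 0 ∧ ∃ i : Fin 3, (r : ℤ) < |x i|} ∩ ↑(box 3 s)) w y} ∩
      {ω | ∃ w y : Site 3, (∀ i : Fin 3, |w i| ≤ (s : ℤ) + 1) ∧ (∃ i : Fin 3, (R : ℤ) ≤ |y i|) ∧
        ω ∈ openConnIn {x : Site 3 | 0 ≤ x 0 ∧ ∃ i : Fin 3, (s : ℤ) < |x i|} w y} := by
  obtain ⟨w, y, hw, hy, hconn⟩ := h
  have hp := DCT16.mem_openConnIn_iff_pathIn.1 hconn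
  have hys : ∃ i : Fin 3, (s : ℤ) ≤ |y i| := by
    obtain ⟨i, hi⟩ := hy
    exact ⟨i, le_trans (by exact_mod_cast hsR.le) hi⟩
  have hwbox : w ∈ (↑(box 3 s) : Set (Site 3)) := by
    rw [Finset.mem_coe, mem_box]
    intro i
    have h1 := abs_le.1 (hw i)
    constructor <;> omega
  refine ⟨?_, ?_⟩
  · obtain ⟨w', y', hw', hy', hp'⟩ := inner_piece hω hrs hw hys hp
    exact ⟨w', y', hw', hy', DCT16.mem_openConnIn_iff_pathIn.2 hp'⟩
  · obtain ⟨w', hw', hp'⟩ := outer_piece hω hsR hwbox hy hp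
    exact ⟨w', y, hw', hy, DCT16.mem_openConnIn_iff_pathIn.2 hp'⟩

/-- The inner piece is contained in `ShellCross_H(r,s)` (drop the constraint `Λ_s`). [folklore] -/
theorem innerPiece_subset (r s : ℕ) :
    {ω : BondConfig (Site 3) | ∃ w y : Site 3, (∀ i : Fin 3, |w i| ≤ (r : ℤ) + 1) ∧
        (∃ i : Fin 3, (s : ℤ) ≤ |y i|) ∧
        ω ∈ openConnIn ({x : Site 3 | 0 ≤ x 0 ∧ ∃ i : Fin 3, (r : ℤ) < |x i|} ∩ ↑(box 3 s)) w y} ⊆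
      {ω | ∃ w y : Site 3, (∀ i : Fin 3, |w i| ≤ (r : ℤ) + 1) ∧ (∃ i : Fin 3, (s : ℤ) ≤ |y i|) ∧
        ω ∈ openConnIn {x : Site 3 | 0 ≤ x 0 ∧ ∃ i : Fin 3, (r : ℤ) < |x i|} w y} := by
  rintro ω ⟨w, y, hw, hy, hω⟩
  exact ⟨w, y, hw, hy, DCT16.mem_openConnIn_iff_pathIn.2
    ((DCT16.mem_openConnIn_iff_pathIn.1 hω).mono Set.inter_subset_left)⟩

/-! ## Determining sets of pairs, disjointness, measurability -/

/-- The inner piece as a countable union of connection events. [folklore] -/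
theorem innerPiece_eq_iUnion (r s : ℕ) :
    {ω : BondConfig (Site 3) | ∃ w y : Site 3, (∀ i : Fin 3, |w i| ≤ (r : ℤ) + 1) ∧
        (∃ i : Fin 3, (s : ℤ) ≤ |y i|) ∧
        ω ∈ openConnIn ({x : Site 3 | 0 ≤ x 0 ∧ ∃ i : Fin 3, (r : ℤ) < |x i|} ∩ ↑(box 3 s)) w y} =
      ⋃ w ∈ {w : Site 3 | ∀ i : Fin 3, |w i| ≤ (r : ℤ) + 1},
        ⋃ y ∈ {y : Site 3 | ∃ i : Fin 3, (s : ℤ) ≤ |y i|},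
          openConnIn ({x : Site 3 | 0 ≤ x 0 ∧ ∃ i : Fin 3, (r : ℤ) < |x i|} ∩ ↑(box 3 s)) w y := by
  ext ω
  simp

/-- **The inner piece is determined by the pairs inside `Λ_s`.** [folklore] -/
theorem determinedBy_innerPiece (r s : ℕ) :
    DeterminedBy {ω : BondConfig (Site 3) | ∃ w y : Site 3, (∀ i : Fin 3, |w i| ≤ (r : ℤ) + 1) ∧
        (∃ i : Fin 3, (s : ℤ) ≤ |y i|) ∧
        ω ∈ openConnIn ({x : Site 3 | 0 ≤ x 0 ∧ ∃ i : Fin 3, (r : ℤ) < |x i|} ∩ ↑(box 3 s)) w y}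
      (↑((box 3 s).sym2) : Set (Sym2 (Site 3))) := by
  rw [innerPiece_eq_iUnion]
  refine DeterminedBy.iUnion fun w => DeterminedBy.iUnion fun _ =>
    DeterminedBy.iUnion fun y => DeterminedBy.iUnion fun _ => ?_
  refine DCT16.determinedBy_openConnIn _ w y ?_
  rw [Finset.coe_sym2]
  intro z hz
  induction z using Sym2.ind with
  | h a b =>
    rw [Set.mk_mem_sym2_iff] at hz ⊢
    exact ⟨hz.1.2, hz.2.2⟩

/-- The inner piece is measurable (finitely determined). [folklore] -/
theorem measurableSet_innerPiece (r s : ℕ) :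
    MeasurableSet {ω : BondConfig (Site 3) | ∃ w y : Site 3, (∀ i : Fin 3, |w i| ≤ (r : ℤ) + 1) ∧
        (∃ i : Fin 3, (s : ℤ) ≤ |y i|) ∧
        ω ∈ openConnIn ({x : Site 3 | 0 ≤ x 0 ∧ ∃ i : Fin 3, (r : ℤ) < |x i|} ∩ ↑(box 3 s)) w y} :=
  (determinedBy_innerPiece r s).measurableSet_of_finset

end ShellCrossSubmult

open MeasureTheory
open Literature.Probability.Percolation Literature.Probability.LatticeModels

/-- **Submultiplicativity of the half-space shell crossing in the ratio.** For every density `p` and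
`r < s < R`: `P_p(ShellCross_H(r,R)) ≤ P_p(ShellCross_H(r,s)) · P_p(ShellCross_H(s,R))` — split the
crossing path at scale `s` (`ShellCrossSubmult.mem_inter_of_mem_shellCross`), use independence of the
pieces (pairs inside `Λ_s` versus pairs inside `H ∩ {‖x‖∞ > s}`: `StubShellSubmult.disjoint_sym2`,
`bondPercolation_real_inter_of_disjoint`) and drop the constraint `Λ_s` on the inner piece. [folklore] -/
theorem shellCross_submult : ∀ p : unitInterval, ∀ r s R : ℕ, r < s → s < R →
    (bondPercolation (zdGraph 3) p).real
        {ω | ∃ w y : Site 3, (∀ i : Fin 3, |w i| ≤ (r : ℤ) + 1) ∧ (∃ i : Fin 3, (R : ℤ) ≤ |y i|) ∧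
          ω ∈ openConnIn {x : Site 3 | 0 ≤ x 0 ∧ ∃ i : Fin 3, (r : ℤ) < |x i|} w y} ≤
      (bondPercolation (zdGraph 3) p).real
          {ω | ∃ w y : Site 3, (∀ i : Fin 3, |w i| ≤ (r : ℤ) + 1) ∧ (∃ i : Fin 3, (s : ℤ) ≤ |y i|) ∧
            ω ∈ openConnIn {x : Site 3 | 0 ≤ x 0 ∧ ∃ i : Fin 3, (r : ℤ) < |x i|} w y} *
        (bondPercolation (zdGraph 3) p).real
          {ω | ∃ w y : Site 3, (∀ i : Fin 3, |w i| ≤ (s : ℤ) + 1) ∧ (∃ i : Fin 3, (R : ℤ) ≤ |y i|) ∧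
            ω ∈ openConnIn {x : Site 3 | 0 ≤ x 0 ∧ ∃ i : Fin 3, (s : ℤ) < |x i|} w y} := by
  intro p r s R hrs hsR
  have h1 := DCT16.real_mono_of_forall_subset_edgeSet (zdGraph 3) p
    (fun ω hω hA => ShellCrossSubmult.mem_inter_of_mem_shellCross hω hrs hsR hA)
  rw [bondPercolation_real_inter_of_disjoint (zdGraph 3) p (StubShellSubmult.disjoint_sym2 s)
    (ShellCrossSubmult.determinedBy_innerPiece r s) (StubShellSubmult.determinedBy_outer s R)
    (ShellCrossSubmult.measurableSet_innerPiece r s) (StubShellSubmult.measurableSet_outer s R)] at h1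
  exact h1.trans (mul_le_mul_of_nonneg_right
    (measureReal_mono (ShellCrossSubmult.innerPiece_subset r s)) measureReal_nonneg)

/-- **Admissible ratios are closed under powers.** If the per-scale shell-decay bound of `stub_shellDecay`
holds at ratio `m ≥ 2` from scale `r₀` on with exponent `b` (at ANY density `p`), then it holds at every
ratio `m^k`, `k ≥ 1`, with the same `r₀` and `b`: `P_p(ShellCross_H(r, m^k r)) ≤ (m^k)^{-b}` for `r ≥ r₀`
(induction on `k` with `shellCross_submult` at the intermediate scale `m^k r`). [folklore] -/
theorem shellDecayWith_pow (p : unitInterval) {m r₀ : ℕ} {b : ℝ} (hm : 2 ≤ m)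
    (hQ : ∀ r : ℕ, r₀ ≤ r →
      (bondPercolation (zdGraph 3) p).real
        {ω | ∃ w y : Site 3, (∀ i : Fin 3, |w i| ≤ (r : ℤ) + 1) ∧ (∃ i : Fin 3, ((m * r : ℕ) : ℤ) ≤ |y i|) ∧
          ω ∈ openConnIn {x : Site 3 | 0 ≤ x 0 ∧ ∃ i : Fin 3, (r : ℤ) < |x i|} w y} ≤ (m : ℝ) ^ (-b)) :
    ∀ k : ℕ, 1 ≤ k → ∀ r : ℕ, r₀ ≤ r → 1 ≤ r →
      (bondPercolation (zdGraph 3) p).real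
        {ω | ∃ w y : Site 3, (∀ i : Fin 3, |w i| ≤ (r : ℤ) + 1) ∧
          (∃ i : Fin 3, ((m ^ k * r : ℕ) : ℤ) ≤ |y i|) ∧
          ω ∈ openConnIn {x : Site 3 | 0 ≤ x 0 ∧ ∃ i : Fin 3, (r : ℤ) < |x i|} w y} ≤
        ((m : ℝ) ^ k) ^ (-b) := by
  have hm1 : 1 < m := lt_of_lt_of_le one_lt_two hm
  have hmR : (0 : ℝ) < m := by exact_mod_cast (lt_trans zero_lt_one hm1)
  intro k hk
  induction k with
  | zero => exact absurd hk (Nat.not_succ_le_zero 0)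
  | succ k ih =>
    intro r hr hr1
    rcases Nat.eq_zero_or_pos k with rfl | hkpos
    · -- `k + 1 = 1`: the hypothesis itself
      have h := hQ r hr
      simpa using h
    · -- split at the intermediate scale `s = m^k r`
      have ih' := ih hkpos r hr hr1
      have hmk : 1 < m ^ k := Nat.one_lt_pow hkpos.ne' hm1
      have hrs : r < m ^ k * r := lt_mul_left hr1 hmk
      have hsR : m ^ k * r < m ^ (k + 1) * r := by
        have : m ^ k < m ^ (k + 1) := Nat.pow_lt_pow_right hm1 (Nat.lt_succ_self k)
        exact Nat.mul_lt_mul_of_pos_right this hr1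
      have hstep := hQ (m ^ k * r) (le_trans hr (le_of_lt hrs))
      have e : m * (m ^ k * r) = m ^ (k + 1) * r := by ring
      rw [e] at hstep
      have hsub := shellCross_submult p r (m ^ k * r) (m ^ (k + 1) * r) hrs hsR
      have hq0 : (0 : ℝ) ≤ ((m : ℝ) ^ k) ^ (-b) := Real.rpow_nonneg (pow_nonneg hmR.le k) _
      calc _ ≤ _ := hsub
        _ ≤ ((m : ℝ) ^ k) ^ (-b) * (m : ℝ) ^ (-b) :=
            mul_le_mul ih' hstep measureReal_nonneg hq0
        _ = ((m : ℝ) ^ (k + 1)) ^ (-b) := by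
            rw [pow_succ, Real.mul_rpow (pow_nonneg hmR.le k) hmR.le]

end Summit.CriticalPhenomena.PercolationContinuityZ3.Theorems

end
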